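import Summits.BirchSwinnertonDyer.BirchSwinnertonDyer.Theorems.SignedLowerHalvesKobayashiLowerHalfSemistableSignDefect
import Literature.NumberTheory.EllipticCurves.Rank1Residual.Typed.X7
import Literature.NumberTheory.EllipticCurves.Kobayashi2003.SignedColemanKatoZetaJoint
import Literature.NumberTheory.EllipticCurves.TateModuleFreeProofs
import HarnessLib

/-!
# Crux `KobayashiLowerHalfLargeImage` (route `SignedLowerHalves`, item 3 = stmt-BirchSwinnertonDyer-19001),
# line `kurihara_rigidity`: the sign-defect seams READ ON CLASS X7 — at an odd supersingular prime the typed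
# Eisenstein half `KobayashiLowerDivisibility W p ε` is Kato's Eisenstein half on every sign-`ε` package, and
# on Kobayashi's JOINT package the crux's `∃ ε` is `∀ ε`

HONEST FRAMING (cell `bsd-ssimc`, seat `bsd-line-slh-p1` LEAD gen 4): TOOL THEOREMS ONLY — no definition,
no named fact minted, no `sorry`, axioms standard; CONDITIONAL on the displayed published facts `h12`
(Kobayashi 2003 Thm. 1.2: `X^ε` is `Λ`-torsion), `h5`/`h3` (Greenberg–Vatsal Rem. 3.4 + Manin: `ord_p ϖ = 0`),
`hPkg` (Kobayashi Thm. 6.2/6.3/7.3 i) + Kato Thm. 12.6 = the tree's `thm62_63_73_signedColemanKato_zeta`) and,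
for the sign swap, either a displayed joint-package hypothesis `hJ` (as in the sibling file for class X6) or
the tree's named fact `Kobayashi2003.thm62_63_73_signedColemanKato_zetaJoint` (both signs on ONE zeta
submodule `Z(T)`, Kobayashi Thm. 5.2 iv) / proof of Thm. 7.4). Nothing here is a theorem about a curve;
the crux, the line and the route stay OPEN; no summit statement is proved; BSD is not proved by any of
this. `--supports stmt-BirchSwinnertonDyer-19001`.

WHAT. The sibling seat `bsd-line-slh-p2` (crux 2, class X6) extracted from Kobayashi's proof of Thm. 7.4
the class-blind pointwise seams of `Theorems/…SemistableSignDefect.lean` (`lowerClause_iff_charIdeal_le`,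
`charIdeal_quot_eq_of_Z_eq`) and read them on class X6 (`…SemistableSignDefectX6.lean`). This file reads
the SAME seams on class X7 (good supersingular `p`, `E` not semistable). The only class input the seams
need is `E[p]` irreducible, which on X7 at an odd prime is AUTOMATIC (`ClassX7.irr`, Serre 1972 §1.11
Prop. 12) — so NO image hypothesis (`Surj`) enters pointwise; `a_p = 0` is carried as a hypothesis (on
X7 it fails only at `p = 3`, `a_3 = ±3`, corner X8).
* §1 `X7.kobayashiLowerDivisibility_iff_katoEisenstein` — `KobayashiLowerDivisibility W p ε` ⟺ Kato's
  Eisenstein inclusion `char X₀ ⊆ char(𝐇¹/Z)` on every sign-`ε` package (Kato Conj. 12.10, lower half,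
  `Δ`-trivial package); `X7.kobayashiLowerDivisibility_of_jointZ` — on a joint package one sign gives the
  other; `X7.exists_kobayashiLowerDivisibility_iff_forall_of_jointZ` — the crux's `∃ ε` is `∀ ε`.
* §2 the same with the joint package BY NAME (`…_zetaJoint`), the three Tate-module instance facts
  discharged in the kernel (`TateModule.continuousSMul_padicInt`, `module_free/finite_tateModule_holds`):
  `X7.exists_kobayashiLowerDivisibility_iff_forall` and `X7.kobayashiLowerDivisibility_iff_katoEisenstein_allSigns`
  (sign-free: `KobayashiLowerDivisibility W p ε` for ONE sign ⟺ Kato's inclusion on EVERY package of EITHER sign).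
So the conclusion `∃ ε, KobayashiLowerDivisibility W p ε` of crux 3 (`KobayashiLowerHalfLargeImage`) is, pair
by pair and modulo the four named facts, exactly Kato's Eisenstein half on the X7 rows — the currency of
the line's engines (Kim 2026 Thm. 1.11 / Castella–Sano Thm. 1 conclude Kato's IMC) and of crux 2 / K_spor.
The class form BY NAME is the companion file `…LargeImageSignDefectX7Crux.lean`.

References: [Kobayashi2003] Thm. 1.2 (p. 2), Thm. 5.2 iv) (p. 9), §5 (p. 10), Thm. 6.2/6.3 (p. 11), Thm. 7.3 i)
(7.21), Thm. 7.4 and its proof (p. 13); [Kato2004Asterisque] Conj. 12.10 (p. 224), Thm. 12.5/12.6 (p. 222);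
[Pollack2003] Thm. 5.6, Cor. 5.11; [GreenbergVatsal2000] §3 Rem. 3.4; [Serre1972] §1.11 Prop. 12.
-/

set_option autoImplicit false
-- single-problem summit (D-0017): the doubled namespace component is by design
set_option linter.dupNamespace false

noncomputable section

open scoped Classical MatrixGroups ModularForm

open CongruenceSubgroup Field WeierstrassCurve Literature.NumberTheory.EllipticCurves
  Literature.NumberTheory.EllipticCurves.ModularForms Literature.NumberTheory.GaloisRepresentations
  Literature.NumberTheory.EllipticCurves.Rank1Residual
  Literature.NumberTheory.EllipticCurves.Rank1Residual.Typed
  Summit.BirchSwinnertonDyer.Rank1Residual.Supersingular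
  Summit.BirchSwinnertonDyer.Rank1Residual.X1

namespace Summit.BirchSwinnertonDyer.BirchSwinnertonDyer.Theorems.SignDefect

/-! ## §1 On class X7 (odd `p`, `a_p = 0`; `good` and `ρ̄` irreducible automatic): the typed Eisenstein half IS
Kato's Eisenstein half, seam by seam; on a joint package the sign is idle -/

section X7

variable (W : WeierstrassCurve ℚ) [W.IsElliptic] [W.IsGloballyMinimal] (p : ℕ) [Fact p.Prime]
  [ContinuousSMul ℤ_[p] (W.tateModule p)] [Module.Free ℤ_[p] (W.tateModule p)]
  [Module.Finite ℤ_[p] (W.tateModule p)]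

/-- **`KobayashiLowerDivisibility W p ε` ⟺ Kato's Eisenstein inclusion on every sign-`ε` package** (class
X7, odd `p`, `a_p = 0`), granted BY NAME Kobayashi Thm. 1.2 (`h12`, torsion of `X^ε`), the period comparisons
`h5`/`h3` (`ord_p ϖ = 0`) and the package construction fact `hPkg` (Kobayashi Thm. 6.2/6.3/7.3 i) + Kato
12.6); Pollack's pair exists unconditionally (`pollack_exists_plusMinusPAdicLFunction_holds`); `E[p]`
irreducible is automatic (`ClassX7.irr`). RHS = `∀` frames, `∀ I Y d`, `char X₀ ⊆ char(𝐇¹/Z)` — Kato's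
Conjecture 12.10, Eisenstein half, read on the `Δ`-trivial package. No image hypothesis.
[cite: Kobayashi2003, Thm. 7.4 and its proof (p. 13)] [cite: Kato2004Asterisque, Conj. 12.10 (p. 224)]
[cite: Serre1972, §1.11 Prop. 12] -/
theorem X7.kobayashiLowerDivisibility_iff_katoEisenstein
    (h12 : Kobayashi2003.thm12_signedSelmerDual_finite_torsion)
    (h5 : realPeriodRat_eq_unit_mul_plusPeriod) (h3 : realPeriodRat_eq_unit_mul_plusPeriod_three)
    (hPkg : Kobayashi2003.thm62_63_73_signedColemanKato_zeta)
    (hp : p ≠ 2) (hX : ClassX7 W p) (hap : W.frobeniusTrace p = 0) (ε : ℤˣ) :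
    KobayashiLowerDivisibility W p ε ↔
    ∀ (κ : ZpExtension ℚ p) (γ : absoluteGaloisGroup ℚ),
      κ.IsCyclotomic → κ.IsTopGenerator γ → IsCyclotomicVariable p γ →
    ∀ [NeZero (W.conductorNorm ℤ)] (f : CuspForm (Gamma0 (W.conductorNorm ℤ)) 2),
      IsNewformOf W f → ∀ (ϖ : ℚ), (ϖ : ℝ) * W.realPeriodRat = plusPeriod f →
    ∀ (I : Kato2004.IwasawaH1Data W p κ γ) (Y : W.FineSelmerDualData κ γ)
      (d : Kobayashi2003.SignedColemanKatoData W p f ϖ κ γ ε I),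
      Module.charIdeal (IwasawaAlgebra p) Y.X ≤ Module.charIdeal (IwasawaAlgebra p) (I.H ⧸ d.Z) := by
  have hgood := hX.1.1
  have hirr := ClassX7.irr W p hp hX
  constructor
  · intro h κ γ hκ hγ hv _ f hf ϖ hϖ I Y d
    obtain ⟨Lplus, Lminus, hL⟩ :=
      exists_isPollackPair pollack_exists_plusMinusPAdicLFunction_holds hp hf hgood hap
    obtain ⟨D⟩ := Kobayashi2003.nonempty_signedSelmerDualData W κ ε hγ
    obtain ⟨-, hDtor⟩ := h12 W p hp hgood hap κ γ hκ hγ ε D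
    have hvϖ : padicValRat p ϖ = 0 := padicValRat_periodRatio_eq_zero h5 h3 W p hp hgood hirr f hf ϖ hϖ
    exact (lowerClause_iff_charIdeal_le W p hirr hγ hf hϖ hvϖ hL D hDtor Y d).mp
      (h κ γ hκ hγ hv f hf ϖ hϖ Lplus Lminus hL D)
  · intro h κ γ hκ hγ hv _ f hf ϖ hϖ Lplus Lminus hL D
    obtain ⟨I⟩ := Kato2004.nonempty_iwasawaH1Data_holds W p κ γ hκ hγ
    obtain ⟨Y⟩ := W.nonempty_fineSelmerDualData κ hγ
    obtain ⟨d⟩ := hPkg W p f ϖ κ γ hp hgood hap hf hϖ hκ hγ hv ε I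
    obtain ⟨-, hDtor⟩ := h12 W p hp hgood hap κ γ hκ hγ ε D
    have hvϖ : padicValRat p ϖ = 0 := padicValRat_periodRatio_eq_zero h5 h3 W p hp hgood hirr f hf ϖ hϖ
    exact (lowerClause_iff_charIdeal_le W p hirr hγ hf hϖ hvϖ hL D hDtor Y d).mpr
      (h κ γ hκ hγ hv f hf ϖ hϖ I Y d)

/-- **Sign swap on a JOINT package** (class X7, odd `p`, `a_p = 0`; `h12`/`h5`/`h3` by name; `hJ` displayed:
for every frame and every pinned `I` there are package data of signs `ε₁`, `ε₂` with THE SAME zeta submodule —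
Kobayashi's three exact sequences in the proof of Thm. 7.4 all start at `𝐇¹(T)^Δ/Z(T)^Δ`). Then
`KobayashiLowerDivisibility W p ε₁ → KobayashiLowerDivisibility W p ε₂`: the Eisenstein half for one sign gives
Kato's Eisenstein inclusion on `𝐇¹/Z`, which gives the Eisenstein half for the other sign. No image hypothesis.
[cite: Kobayashi2003, Thm. 7.4 and its proof (p. 13), §5 (p. 10)] [cite: Serre1972, §1.11 Prop. 12] -/
theorem X7.kobayashiLowerDivisibility_of_jointZ
    (h12 : Kobayashi2003.thm12_signedSelmerDual_finite_torsion)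
    (h5 : realPeriodRat_eq_unit_mul_plusPeriod) (h3 : realPeriodRat_eq_unit_mul_plusPeriod_three)
    (hp : p ≠ 2) (hX : ClassX7 W p) (hap : W.frobeniusTrace p = 0) {ε₁ ε₂ : ℤˣ}
    (hJ : ∀ (κ : ZpExtension ℚ p) (γ : absoluteGaloisGroup ℚ),
      κ.IsCyclotomic → κ.IsTopGenerator γ → IsCyclotomicVariable p γ →
      ∀ [NeZero (W.conductorNorm ℤ)] (f : CuspForm (Gamma0 (W.conductorNorm ℤ)) 2),
        IsNewformOf W f → ∀ (ϖ : ℚ), (ϖ : ℝ) * W.realPeriodRat = plusPeriod f →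
      ∀ (I : Kato2004.IwasawaH1Data W p κ γ),
        ∃ (d₁ : Kobayashi2003.SignedColemanKatoData W p f ϖ κ γ ε₁ I)
          (d₂ : Kobayashi2003.SignedColemanKatoData W p f ϖ κ γ ε₂ I), d₁.Z = d₂.Z)
    (h : KobayashiLowerDivisibility W p ε₁) : KobayashiLowerDivisibility W p ε₂ := by
  have hgood := hX.1.1
  have hirr := ClassX7.irr W p hp hX
  intro κ γ hκ hγ hv _ f hf ϖ hϖ Lplus Lminus hL D₂
  obtain ⟨I⟩ := Kato2004.nonempty_iwasawaH1Data_holds W p κ γ hκ hγ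
  obtain ⟨Y⟩ := W.nonempty_fineSelmerDualData κ hγ
  obtain ⟨d₁, d₂, hZ⟩ := hJ κ γ hκ hγ hv f hf ϖ hϖ I
  obtain ⟨D₁⟩ := Kobayashi2003.nonempty_signedSelmerDualData W κ ε₁ hγ
  obtain ⟨-, hD₁tor⟩ := h12 W p hp hgood hap κ γ hκ hγ ε₁ D₁
  obtain ⟨-, hD₂tor⟩ := h12 W p hp hgood hap κ γ hκ hγ ε₂ D₂
  have hvϖ : padicValRat p ϖ = 0 := padicValRat_periodRatio_eq_zero h5 h3 W p hp hgood hirr f hf ϖ hϖ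
  have hE₁ := (lowerClause_iff_charIdeal_le W p hirr hγ hf hϖ hvϖ hL D₁ hD₁tor Y d₁).mp
    (h κ γ hκ hγ hv f hf ϖ hϖ Lplus Lminus hL D₁)
  rw [charIdeal_quot_eq_of_Z_eq W p d₁ d₂ hZ] at hE₁
  exact (lowerClause_iff_charIdeal_le W p hirr hγ hf hϖ hvϖ hL D₂ hD₂tor Y d₂).mpr hE₁

/-- **The existential sign is idle on a joint package** (class X7, odd `p`, `a_p = 0`; `h12`/`h5`/`h3` by name;
joint packages `hJ` for the two signs `(1, −1)` displayed): `(∃ ε, KobayashiLowerDivisibility W p ε) ↔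
∀ ε, KobayashiLowerDivisibility W p ε` (`ℤˣ = {1, −1}` and `X7.kobayashiLowerDivisibility_of_jointZ` both
ways). So the conclusion `∃ ε, …` of cruxes 3/4 of the route asks, pair by pair, for Kato's Eisenstein half,
no more, no less. No image hypothesis. [cite: Kobayashi2003, Thm. 7.4 (p. 13)] [cite: Serre1972, §1.11 Prop. 12] -/
theorem X7.exists_kobayashiLowerDivisibility_iff_forall_of_jointZ
    (h12 : Kobayashi2003.thm12_signedSelmerDual_finite_torsion)
    (h5 : realPeriodRat_eq_unit_mul_plusPeriod) (h3 : realPeriodRat_eq_unit_mul_plusPeriod_three)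
    (hp : p ≠ 2) (hX : ClassX7 W p) (hap : W.frobeniusTrace p = 0)
    (hJ : ∀ (κ : ZpExtension ℚ p) (γ : absoluteGaloisGroup ℚ),
      κ.IsCyclotomic → κ.IsTopGenerator γ → IsCyclotomicVariable p γ →
      ∀ [NeZero (W.conductorNorm ℤ)] (f : CuspForm (Gamma0 (W.conductorNorm ℤ)) 2),
        IsNewformOf W f → ∀ (ϖ : ℚ), (ϖ : ℝ) * W.realPeriodRat = plusPeriod f →
      ∀ (I : Kato2004.IwasawaH1Data W p κ γ),
        ∃ (d₁ : Kobayashi2003.SignedColemanKatoData W p f ϖ κ γ 1 I)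
          (d₂ : Kobayashi2003.SignedColemanKatoData W p f ϖ κ γ (-1) I), d₁.Z = d₂.Z) :
    (∃ ε : ℤˣ, KobayashiLowerDivisibility W p ε) ↔ ∀ ε : ℤˣ, KobayashiLowerDivisibility W p ε := by
  refine ⟨fun ⟨ε₀, h⟩ ε ↦ ?_, fun h ↦ ⟨1, h 1⟩⟩
  have hJ' : ∀ (κ : ZpExtension ℚ p) (γ : absoluteGaloisGroup ℚ),
      κ.IsCyclotomic → κ.IsTopGenerator γ → IsCyclotomicVariable p γ →
      ∀ [NeZero (W.conductorNorm ℤ)] (f : CuspForm (Gamma0 (W.conductorNorm ℤ)) 2),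
        IsNewformOf W f → ∀ (ϖ : ℚ), (ϖ : ℝ) * W.realPeriodRat = plusPeriod f →
      ∀ (I : Kato2004.IwasawaH1Data W p κ γ),
        ∃ (d₁ : Kobayashi2003.SignedColemanKatoData W p f ϖ κ γ (-1) I)
          (d₂ : Kobayashi2003.SignedColemanKatoData W p f ϖ κ γ 1 I), d₁.Z = d₂.Z := by
    intro κ γ hκ hγ hv _ f hf ϖ hϖ I
    obtain ⟨d₁, d₂, hZ⟩ := hJ κ γ hκ hγ hv f hf ϖ hϖ I
    exact ⟨d₂, d₁, hZ.symm⟩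
  rcases Int.units_eq_one_or ε₀ with rfl | rfl <;> rcases Int.units_eq_one_or ε with rfl | rfl
  · exact h
  · exact X7.kobayashiLowerDivisibility_of_jointZ W p h12 h5 h3 hp hX hap hJ h
  · exact X7.kobayashiLowerDivisibility_of_jointZ W p h12 h5 h3 hp hX hap hJ' h
  · exact h

end X7

/-! ## §2 The same with Kobayashi's joint package BY NAME (`thm62_63_73_signedColemanKato_zetaJoint`) and the
Tate-module instance facts discharged in the kernel -/

section X7Named

variable (W : WeierstrassCurve ℚ) [W.IsElliptic] [W.IsGloballyMinimal] (p : ℕ) [Fact p.Prime]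

/-- **The existential sign is idle, joint package by name** (class X7, odd `p`, `a_p = 0`): granted Kobayashi
Thm. 1.2 (`h12`), the period facts (`h5`/`h3`) and the JOINT package construction fact
`Kobayashi2003.thm62_63_73_signedColemanKato_zetaJoint` (`hJ`; Thm. 5.2 iv), 6.2/6.3, 7.3 i), proof of 7.4 with
Kato 12.5/12.6), `(∃ ε, KobayashiLowerDivisibility W p ε) ↔ ∀ ε, KobayashiLowerDivisibility W p ε`. The three
Tate-module structure facts the package binds are kernel theorems (`TateModule.continuousSMul_padicInt`,
`module_free_tateModule_holds`, `module_finite_tateModule_holds`). No image hypothesis.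
[cite: Kobayashi2003, Thm. 5.2 iv) (p. 9), Thm. 7.4 and its proof (p. 13)] [cite: Serre1972, §1.11 Prop. 12] -/
theorem X7.exists_kobayashiLowerDivisibility_iff_forall
    (h12 : Kobayashi2003.thm12_signedSelmerDual_finite_torsion)
    (h5 : realPeriodRat_eq_unit_mul_plusPeriod) (h3 : realPeriodRat_eq_unit_mul_plusPeriod_three)
    (hJ : Kobayashi2003.thm62_63_73_signedColemanKato_zetaJoint)
    (hp : p ≠ 2) (hX : ClassX7 W p) (hap : W.frobeniusTrace p = 0) :
    (∃ ε : ℤˣ, KobayashiLowerDivisibility W p ε) ↔ ∀ ε : ℤˣ, KobayashiLowerDivisibility W p ε := by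
  haveI : ContinuousSMul ℤ_[p] (W.tateModule p) := TateModule.continuousSMul_padicInt
  haveI : Module.Free ℤ_[p] (W.tateModule p) := W.module_free_tateModule_holds p
  haveI : Module.Finite ℤ_[p] (W.tateModule p) := W.module_finite_tateModule_holds p
  refine X7.exists_kobayashiLowerDivisibility_iff_forall_of_jointZ W p h12 h5 h3 hp hX hap ?_
  intro κ γ hκ hγ hv _ f hf ϖ hϖ I
  exact hJ W p f ϖ κ γ hp hX.1.1 hap hf hϖ hκ hγ hv I

/-- **Sign-free Kato currency, joint package by name** (class X7, odd `p`, `a_p = 0`; `h12`/`h5`/`h3`/`hJ` by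
name): for ANY sign `ε`, `KobayashiLowerDivisibility W p ε` ⟺ Kato's Eisenstein inclusion
`char X₀ ⊆ char(𝐇¹/Z)` on EVERY package of EITHER sign at every frame (the Tate-module instances of the
right-hand side are binders, as in the package facts). `⇒`: the sign is idle (`…_iff_forall`), then §1 for
each sign; `⇐`: specialise to the packages of sign `ε`. No image hypothesis.
[cite: Kobayashi2003, Thm. 7.4 and its proof (p. 13)] [cite: Kato2004Asterisque, Conj. 12.10 (p. 224)]
[cite: Serre1972, §1.11 Prop. 12] -/
theorem X7.kobayashiLowerDivisibility_iff_katoEisenstein_allSigns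
    (h12 : Kobayashi2003.thm12_signedSelmerDual_finite_torsion)
    (h5 : realPeriodRat_eq_unit_mul_plusPeriod) (h3 : realPeriodRat_eq_unit_mul_plusPeriod_three)
    (hJ : Kobayashi2003.thm62_63_73_signedColemanKato_zetaJoint)
    (hp : p ≠ 2) (hX : ClassX7 W p) (hap : W.frobeniusTrace p = 0) (ε : ℤˣ) :
    KobayashiLowerDivisibility W p ε ↔
    ∀ [ContinuousSMul ℤ_[p] (W.tateModule p)] [Module.Free ℤ_[p] (W.tateModule p)]
      [Module.Finite ℤ_[p] (W.tateModule p)],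
    ∀ (κ : ZpExtension ℚ p) (γ : absoluteGaloisGroup ℚ),
      κ.IsCyclotomic → κ.IsTopGenerator γ → IsCyclotomicVariable p γ →
    ∀ [NeZero (W.conductorNorm ℤ)] (f : CuspForm (Gamma0 (W.conductorNorm ℤ)) 2),
      IsNewformOf W f → ∀ (ϖ : ℚ), (ϖ : ℝ) * W.realPeriodRat = plusPeriod f →
    ∀ (ε' : ℤˣ) (I : Kato2004.IwasawaH1Data W p κ γ) (Y : W.FineSelmerDualData κ γ)
      (d : Kobayashi2003.SignedColemanKatoData W p f ϖ κ γ ε' I),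
      Module.charIdeal (IwasawaAlgebra p) Y.X ≤ Module.charIdeal (IwasawaAlgebra p) (I.H ⧸ d.Z) := by
  have hPkg := Kobayashi2003.thm62_63_73_signedColemanKato_zeta_of_joint hJ
  constructor
  · intro h _ _ _ κ γ hκ hγ hv _ f hf ϖ hϖ ε' I Y d
    have hall : ∀ ε'' : ℤˣ, KobayashiLowerDivisibility W p ε'' :=
      (X7.exists_kobayashiLowerDivisibility_iff_forall W p h12 h5 h3 hJ hp hX hap).mp ⟨ε, h⟩
    exact (X7.kobayashiLowerDivisibility_iff_katoEisenstein W p h12 h5 h3 hPkg hp hX hap ε').mp (hall ε')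
      κ γ hκ hγ hv f hf ϖ hϖ I Y d
  · intro h
    haveI : ContinuousSMul ℤ_[p] (W.tateModule p) := TateModule.continuousSMul_padicInt
    haveI : Module.Free ℤ_[p] (W.tateModule p) := W.module_free_tateModule_holds p
    haveI : Module.Finite ℤ_[p] (W.tateModule p) := W.module_finite_tateModule_holds p
    exact (X7.kobayashiLowerDivisibility_iff_katoEisenstein W p h12 h5 h3 hPkg hp hX hap ε).mpr
      fun κ γ hκ hγ hv _ f hf ϖ hϖ I Y d ↦ h κ γ hκ hγ hv f hf ϖ hϖ ε I Y d

end X7Named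

end Summit.BirchSwinnertonDyer.BirchSwinnertonDyer.Theorems.SignDefect

end
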